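import Summits.ValiantsHypothesis.ValiantsHypothesis.Theorems.GrenetZeonDualUnipotentThreeHalvesLongMassSubmoduleCeilings
import Literature.LinearAlgebra.MeshulamBoundedRank

/-!
# `GrenetZeon.DualUnipotentThreeHalves` (stmt-ValiantsHypothesis-24318), line `slow_core`, stub (c) `SlowCore.LongMassSlowLawInv`:
# THE RANK CEILING (U3) — Flanders–Meshulam BY NAME: price `≤ r·b` on spaces of generic rank `≤ r`

The 26th hand's census (`Cruxes/DualUnipotentThreeHalves/CENSUS-leafhand2-g25-structural-laws.md` §3 (R4)) listed FLANDERS' DIMENSION THEOREM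
(`dim V ≤ r·b` for a linear space `V ≤ M_b(ℂ)` all of whose members have rank `≤ r`) as kernel work still to be done.  It is ALREADY in the
tree, over every field: `Literature.LinearAlgebra.Meshulam1985_exists_rank_gt_holds` (R. Meshulam 1985, Thm. 2, proved in
`Literature/LinearAlgebra/MeshulamBoundedRank.lean`) with the corollary `Literature.LinearAlgebra.finrank_le_mul_of_forall_rank_le`.
This file records the consequence for the intrinsic (c)-price in the SUBMODULE currency of ✓ `longMassSlowLawInv_iff_submodule`
(`…LongMassSubmodule`), next to the two universal ceilings FREEZE (U1, ✓ `price_freeze_submodule`) and ABSORB (U2, ✓ `price_absorb_submodule`):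

* ★ `finrank_le_maxRank_mul` — Flanders at a max-rank element: `A ∈ V` of maximal rank ⇒ `dim V ≤ rank A · b` (the dimension count that the
  transport laws ✓ `NilSpaceMaxRank.exists_mulVec_eq_of_maxRank` / ✓ `exists_mulVec_add_mulVec_eq_of_maxRank` were landed for — by name, no count
  needed).
* ★★ `price_rank_submodule` — (U3) RANK CEILING: every `V ≤ M_b(ℂ)` whose members have rank `≤ r` has a certificate of price `≤ r·b`
  (`W = ⊥`, `k = 0`; freeze + Flanders).  Normalised: `price_rank_submodule_sqrt` — generic rank `≤ c·⌊√n⌋` ⇒ price `≤ c·(⌊√n⌋·b)`, i.e. (c)'s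
  conclusion with constant `c` on the bounded-generic-rank locus (no nilpotency used).
* ★ `exists_rank_mul_gt_of_expensive` — VIOLATOR PORTRAIT, rank line: if `V` has NO certificate of price `≤ P`, then some `A ∈ V` has
  `rank A · b > P`.  With V34's shape (mass `μ ≫ √n·b` is forced on a violator family by the freeze ceiling) this is the same constraint read
  through Flanders: a (c)-violator family has GENERIC RANK `r ≫ √n` (indeed `r ≥ μ/b`), on top of index `H ≫ b/√n` (absorb ceiling).

HONEST FRAMING.  Bookkeeping / census correction (`--supports stmt-ValiantsHypothesis-24318`): a ceiling, NOT progress on the research stub (c)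
`SlowCore.LongMassSlowLawInv`; closes no stub; S3, 24318, 8062 and `VP ≠ VNP` are NOT proved.  Def-free, no named-fact hypotheses (Meshulam's
theorem is a PROVED Literature fact, used by name), no sorry.
[cite: Flanders1962, Thm. 1] [cite: Meshulam1985, Thm. 2 (p. 226)]
-/

set_option linter.dupNamespace false
set_option autoImplicit false

noncomputable section

namespace Summit.ValiantsHypothesis.ValiantsHypothesis.Theorems.GrenetZeon.NilSpaceRankCeiling

open MvPolynomial Matrix
open scoped BigOperators
open Summit.ValiantsHypothesis.ValiantsHypothesis.Theorems.GrenetZeon.LongMassHomogenise (window_bot)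

variable {b : ℕ}

/-! ## §1 Flanders' bound by name -/

/-- **Flanders–Meshulam** (by name: ✓ `Literature.LinearAlgebra.finrank_le_mul_of_forall_rank_le`): a linear space of `b × b` complex matrices
all of rank `≤ r` has dimension `≤ r·b`. [cite: Flanders1962, Thm. 1] [cite: Meshulam1985, Thm. 2 (p. 226)] -/
theorem finrank_le_rank_mul (V : Submodule ℂ (Matrix (Fin b) (Fin b) ℂ)) {r : ℕ} (hV : ∀ A ∈ V, A.rank ≤ r) :
    Module.finrank ℂ V ≤ r * b :=
  Literature.LinearAlgebra.finrank_le_mul_of_forall_rank_le (Literature.LinearAlgebra.Meshulam1985_exists_rank_gt_holds ℂ) V hV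

/-- ★ **Flanders at a max-rank element**: if `A ∈ V` has maximal rank in `V ≤ M_b(ℂ)`, then `dim V ≤ rank A · b`.  (The count behind the
transport laws ✓ `NilSpaceMaxRank.exists_mulVec_eq_of_maxRank`, ✓ `exists_mulVec_add_mulVec_eq_of_maxRank`.) [cite: Flanders1962, Thm. 1] -/
theorem finrank_le_maxRank_mul (V : Submodule ℂ (Matrix (Fin b) (Fin b) ℂ)) {A : Matrix (Fin b) (Fin b) ℂ}
    (hmax : ∀ B ∈ V, B.rank ≤ A.rank) : Module.finrank ℂ V ≤ A.rank * b :=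
  finrank_le_rank_mul V hmax

/-- Every linear space of matrices has a member of maximal rank (ranks are bounded by `b`). -/
theorem exists_maxRank (V : Submodule ℂ (Matrix (Fin b) (Fin b) ℂ)) : ∃ A ∈ V, ∀ B ∈ V, B.rank ≤ A.rank := by
  classical
  set r := Nat.findGreatest (fun k => ∃ A ∈ V, A.rank = k) b with hr
  have hex : ∃ A ∈ V, A.rank = r := by
    have h0 : ∃ A ∈ V, A.rank = 0 := ⟨0, V.zero_mem, by rw [Matrix.rank_zero]⟩
    by_cases hr0 : r = 0
    · rw [hr0]; exact h0
    · exact Nat.findGreatest_of_ne_zero hr.symm hr0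
  obtain ⟨A, hA, hAr⟩ := hex
  refine ⟨A, hA, fun B hB => ?_⟩
  rw [hAr, hr]
  refine Nat.le_findGreatest ?_ ⟨B, hB, rfl⟩
  simpa only [Fintype.card_fin] using Matrix.rank_le_width B

/-! ## §2 (U3) The rank ceiling in the submodule currency of (c) -/

/-- ★★ **(U3) RANK CEILING** (submodule currency of ✓ `longMassSlowLawInv_iff_submodule`): if every member of `V ≤ M_b(ℂ)` has rank `≤ r`,
then `V` has a certificate of price `≤ r·b` for every window `n` (`W = ⊥`, `k = 0`: freeze, priced by Flanders–Meshulam instead of `dim V`).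
[cite: Meshulam1985, Thm. 2 (p. 226)] -/
theorem price_rank_submodule (V : Submodule ℂ (Matrix (Fin b) (Fin b) ℂ)) {r : ℕ} (hV : ∀ A ∈ V, A.rank ≤ r) (n : ℕ) :
    ∃ (W : Submodule ℂ (Matrix (Fin b) (Fin b) ℂ)) (k : ℕ), W ≤ V ∧
      (∀ A ∈ V, ∀ w ∈ W, ∀ p : ℕ, p ≤ n - 1 → ∀ i j : Fin b,
        ((((A.map (C : ℂ → MvPolynomial (Fin 1) ℂ) + (X 0 : MvPolynomial (Fin 1) ℂ) • w.map C) ^ p :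
          Matrix (Fin b) (Fin b) (MvPolynomial (Fin 1) ℂ)) i j).totalDegree ≤ k)) ∧
      n * k + (Module.finrank ℂ V - Module.finrank ℂ W) ≤ r * b := by
  refine ⟨⊥, 0, bot_le, fun A _ w hw p _ i j => window_bot A w hw p i j, ?_⟩
  have h := finrank_le_rank_mul V hV
  simp only [mul_zero, zero_add, finrank_bot, Nat.sub_zero]
  exact h

/-- ★ **(U3) normalised to (c)'s budget**: generic rank `≤ c·⌊√n⌋` ⇒ a certificate of price `≤ c·(⌊√n⌋·b)` — the conclusion of (c) with
constant `c`, on the bounded-generic-rank locus, for EVERY `V` (nilpotency not used). [cite: Meshulam1985, Thm. 2 (p. 226)] -/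
theorem price_rank_submodule_sqrt (V : Submodule ℂ (Matrix (Fin b) (Fin b) ℂ)) (c n : ℕ) (hV : ∀ A ∈ V, A.rank ≤ c * Nat.sqrt n) :
    ∃ (W : Submodule ℂ (Matrix (Fin b) (Fin b) ℂ)) (k : ℕ), W ≤ V ∧
      (∀ A ∈ V, ∀ w ∈ W, ∀ p : ℕ, p ≤ n - 1 → ∀ i j : Fin b,
        ((((A.map (C : ℂ → MvPolynomial (Fin 1) ℂ) + (X 0 : MvPolynomial (Fin 1) ℂ) • w.map C) ^ p :
          Matrix (Fin b) (Fin b) (MvPolynomial (Fin 1) ℂ)) i j).totalDegree ≤ k)) ∧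
      n * k + (Module.finrank ℂ V - Module.finrank ℂ W) ≤ c * (Nat.sqrt n * b) := by
  have h := price_rank_submodule V hV n
  rwa [mul_assoc] at h

/-! ## §3 The violator portrait, rank line -/

/-- ★ **EXPENSIVE SPACES HAVE A MEMBER OF LARGE RANK.**  If `V ≤ M_b(ℂ)` has NO certificate of price `≤ P` for the window `n` (every
`W ≤ V`, `k` with the window property cost `> P`), then some `A ∈ V` has `rank A · b > P`.  For the (c)-budget `P = c·⌊√n⌋·b`: a
(c)-violator contains a matrix of rank `> c·⌊√n⌋` — the rank line of V34's violator portrait (mass `μ = dim V ≤ r_gen · b`, Flanders).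
[cite: Flanders1962, Thm. 1] [cite: Meshulam1985, Thm. 2 (p. 226)] -/
theorem exists_rank_mul_gt_of_expensive (V : Submodule ℂ (Matrix (Fin b) (Fin b) ℂ)) (n P : ℕ)
    (hexp : ∀ (W : Submodule ℂ (Matrix (Fin b) (Fin b) ℂ)) (k : ℕ), W ≤ V →
      (∀ A ∈ V, ∀ w ∈ W, ∀ p : ℕ, p ≤ n - 1 → ∀ i j : Fin b,
        ((((A.map (C : ℂ → MvPolynomial (Fin 1) ℂ) + (X 0 : MvPolynomial (Fin 1) ℂ) • w.map C) ^ p :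
          Matrix (Fin b) (Fin b) (MvPolynomial (Fin 1) ℂ)) i j).totalDegree ≤ k)) →
      P < n * k + (Module.finrank ℂ V - Module.finrank ℂ W)) :
    ∃ A ∈ V, P < A.rank * b := by
  obtain ⟨A, hA, hmax⟩ := exists_maxRank V
  refine ⟨A, hA, ?_⟩
  obtain ⟨W, k, hW, hwin, hprice⟩ := price_rank_submodule V hmax n
  exact lt_of_lt_of_le (hexp W k hW hwin) hprice

/-- The same read as a bound on the generic rank: an expensive space (`price > c·(⌊√n⌋·b)`) contains a matrix of rank `> c·⌊√n⌋`.
[cite: Meshulam1985, Thm. 2 (p. 226)] -/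
theorem exists_rank_gt_sqrt_of_expensive (V : Submodule ℂ (Matrix (Fin b) (Fin b) ℂ)) (n c : ℕ)
    (hexp : ∀ (W : Submodule ℂ (Matrix (Fin b) (Fin b) ℂ)) (k : ℕ), W ≤ V →
      (∀ A ∈ V, ∀ w ∈ W, ∀ p : ℕ, p ≤ n - 1 → ∀ i j : Fin b,
        ((((A.map (C : ℂ → MvPolynomial (Fin 1) ℂ) + (X 0 : MvPolynomial (Fin 1) ℂ) • w.map C) ^ p :
          Matrix (Fin b) (Fin b) (MvPolynomial (Fin 1) ℂ)) i j).totalDegree ≤ k)) →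
      c * (Nat.sqrt n * b) < n * k + (Module.finrank ℂ V - Module.finrank ℂ W)) :
    ∃ A ∈ V, c * Nat.sqrt n < A.rank := by
  obtain ⟨A, hA, hlt⟩ := exists_rank_mul_gt_of_expensive V n (c * (Nat.sqrt n * b)) hexp
  refine ⟨A, hA, ?_⟩
  by_contra hle
  push Not at hle
  have : A.rank * b ≤ c * (Nat.sqrt n * b) := by
    rw [← mul_assoc]; exact Nat.mul_le_mul_right b hle
  omega

end Summit.ValiantsHypothesis.ValiantsHypothesis.Theorems.GrenetZeon.NilSpaceRankCeiling

end
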